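import Mathlib
import HarnessLib

/-!
# `NoHeavyLowerTail` (crux stmt-CriticalPhenomena-4575), antithetic vdBHK programme: the PURE (ι-free, localized) HUB LEMMA

Support file (seat `prim-ineq-gen-7` gen 29; `--supports stmt-CriticalPhenomena-4575`).  Nothing is asserted about the crux; no `sorry`,
no definitions.  Memo: run/shared/lean/prim/prim-ineq-gen-7/FINDING-PURE-g29.md §1–§3.

CONTEXT.  The per-tree certificate inequality `(***)` of the tree-block reduction (FINDING-TREEBLOCK-g25.md) reads, for up-sets
`a, a′, b, b′` of the colouring poset `F_v` of a rooted tree (involution `ι` = colour swap),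
`val(Y) = Σ_ρ (1_a ρ − 1_{a′}(ιρ))(1_b ρ − 1_{b′}(ιρ)) + #(Cert₁ ∪ Cert₂) ≥ 0`.
Gen 29 observes that for trees of ROOT DEGREE ONE the stronger, `ι`-FREE inequality
`PURE(Y) = Σ_ρ (1_a ρ − 1_{a′} ρ)(1_b ρ − 1_{b′} ρ) + #(Cert₁ ∪ Cert₂) ≥ 0`
holds in every computed case, and even LOCALIZED: `Σ_{ρ ∈ Z} [ (1_a−1_{a′})(1_b−1_{b′})(ρ) + 1_{Cert}(ρ) ] ≥ 0` for every DOWN-SET `Z`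
("L-PURE"; equivalently a Hall condition: the deficit tops are matched to payers below them).  `PURE ⟹ (***)` is two instances of the
antipodal Kleitman inequality of `F_v` (`pure_le_mixed` below, with the two instances as hypotheses).

HUB STEP (root edge `f = vw`, `deg w = 2`, arbitrary subtree below; `T/f` = contraction): `L-PURE_T(Z) − L-PURE_{T/f}(Z ∩ F′)` is a sum
over hub levels `y` of the terms of `B_y`, `T_y` and the new-minus-old certificate of the `F′`-top `τ_y`; as `B_y < T_y`, `B_y < τ_y`, a down-set
meets a level in a pattern `∅, {B}, {B,T}, {B,τ}, {B,T,τ}`, and each partial sum is `≥ 0` in all `4096` admissible configurations of the sixteen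
bits of `AntitheticHub.hub_local` (gen 26) — POINTWISE, no Kleitman mixing.  Hence `L-PURE(T/f) ⟹ L-PURE(T)`: L-PURE, PURE and `(***)` hold
for every path rooted at an end and are inherited under subdivision of the root edge.

* `AntitheticPureHub.pure_hub_local_B`, `…_BT`, `…_Bτ`, `…_all` — the four partial sums (finite checks by `decide`).
* `AntitheticPureHub.pure_hub_charge` — the summed form with a down-set pattern `ZT ⊆ ZB`, `Zτ ⊆ ZB` over any finite index type.
* `AntitheticPureHub.pure_le_mixed` — `Σ (1_a − 1_{a′})(1_b − 1_{b′}) ≤ Σ (1_a − 1_{a′}∘ι)(1_b − 1_{b′}∘ι)` for an involution `ι`, given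
  `#(a ∩ ι b′) ≤ #(a ∩ b′)` and `#(ι a′ ∩ b) ≤ #(a′ ∩ b)` (the two antipodal-Kleitman instances).
-/

namespace Summit.CriticalPhenomena.PercolationContinuityZ3.Theorems

open Finset

namespace AntitheticPureHub

set_option synthInstance.maxSize 100000 in
/-- pattern `{B}`: the hub bottom alone, `q_B ≥ 0` (`decide`). -/
private theorem loc_B : ∀ (aB aT a'B a'T bB bT b'B b'T : Bool),
    (aB = true → aT = true) → (a'B = true → a'T = true) → (bB = true → bT = true) → (b'B = true → b'T = true) →
    0 ≤ ((if aB then (1:ℤ) else 0) - (if a'B then (1:ℤ) else 0)) * ((if bB then (1:ℤ) else 0) - (if b'B then (1:ℤ) else 0))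
      + (if ((aT ∧ ¬ a'B ∧ ¬ bB ∧ b'T) ∨ (¬ aB ∧ a'T ∧ bT ∧ ¬ b'B)) then (1:ℤ) else 0) := by
  decide

/-- **LOCALIZED PURE HUB LEMMA**, pattern `{B}`: the hub bottom alone, `q_B ≥ 0`.  Sixteen bits (for each of `a, a′, b, b′`: membership of the hub bottom `B`,
the hub top `T`, of some `F′`-bottom below the hub top (`α`), of the `F′`-top `τ`), constrained by `B ⇒ T`, `α ⇒ T`, `B ⇒ τ`;
pointwise products (no involution).  (Bits and constraints not entering this pattern are carried for a uniform interface.) [this work] -/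
theorem pure_hub_local_B (aB aT aα aτ a'B a'T a'α a'τ bB bT bα bτ b'B b'T b'α b'τ : Bool)
    (h1 : aB = true → aT = true)
    (_h2 : aα = true → aT = true)
    (_h3 : aB = true → aτ = true)
    (h4 : a'B = true → a'T = true)
    (_h5 : a'α = true → a'T = true)
    (_h6 : a'B = true → a'τ = true)
    (h7 : bB = true → bT = true)
    (_h8 : bα = true → bT = true)
    (_h9 : bB = true → bτ = true)
    (h10 : b'B = true → b'T = true)
    (_h11 : b'α = true → b'T = true)
    (_h12 : b'B = true → b'τ = true) :
    0 ≤ ((if aB then (1:ℤ) else 0) - (if a'B then (1:ℤ) else 0)) * ((if bB then (1:ℤ) else 0) - (if b'B then (1:ℤ) else 0))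
      + (if ((aT ∧ ¬ a'B ∧ ¬ bB ∧ b'T) ∨ (¬ aB ∧ a'T ∧ bT ∧ ¬ b'B)) then (1:ℤ) else 0) := by
  exact loc_B aB aT a'B a'T bB bT b'B b'T h1 h4 h7 h10

set_option synthInstance.maxSize 100000 in
/-- pattern `{B,T}`: hub bottom and hub top, `q_B + q_T ≥ 0`, with the `α`-bits of `a, a′` fixed to `true, true` (`decide`). -/
private theorem loc_BT_tt : ∀ (aB aT a'B a'T bB bT bα b'B b'T b'α : Bool),
    (aB = true → aT = true) → (true = true → aT = true) → (a'B = true → a'T = true) → (true = true → a'T = true) → (bB = true → bT = true) → (bα = true → bT = true) → (b'B = true → b'T = true) → (b'α = true → b'T = true) →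
    0 ≤ ((if aB then (1:ℤ) else 0) - (if a'B then (1:ℤ) else 0)) * ((if bB then (1:ℤ) else 0) - (if b'B then (1:ℤ) else 0))
      + (if ((aT ∧ ¬ a'B ∧ ¬ bB ∧ b'T) ∨ (¬ aB ∧ a'T ∧ bT ∧ ¬ b'B)) then (1:ℤ) else 0)
      + ((if aT then (1:ℤ) else 0) - (if a'T then (1:ℤ) else 0)) * ((if bT then (1:ℤ) else 0) - (if b'T then (1:ℤ) else 0))
      + (if (((aB ∨ true) ∧ (b'B ∨ b'α) ∧ ¬ a'T ∧ ¬ bT) ∨ ((a'B ∨ true) ∧ (bB ∨ bα) ∧ ¬ aT ∧ ¬ b'T)) then (1:ℤ) else 0) := by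
  decide

set_option synthInstance.maxSize 100000 in
/-- pattern `{B,T}`: hub bottom and hub top, `q_B + q_T ≥ 0`, with the `α`-bits of `a, a′` fixed to `true, false` (`decide`). -/
private theorem loc_BT_tf : ∀ (aB aT a'B a'T bB bT bα b'B b'T b'α : Bool),
    (aB = true → aT = true) → (true = true → aT = true) → (a'B = true → a'T = true) → (false = true → a'T = true) → (bB = true → bT = true) → (bα = true → bT = true) → (b'B = true → b'T = true) → (b'α = true → b'T = true) →
    0 ≤ ((if aB then (1:ℤ) else 0) - (if a'B then (1:ℤ) else 0)) * ((if bB then (1:ℤ) else 0) - (if b'B then (1:ℤ) else 0))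
      + (if ((aT ∧ ¬ a'B ∧ ¬ bB ∧ b'T) ∨ (¬ aB ∧ a'T ∧ bT ∧ ¬ b'B)) then (1:ℤ) else 0)
      + ((if aT then (1:ℤ) else 0) - (if a'T then (1:ℤ) else 0)) * ((if bT then (1:ℤ) else 0) - (if b'T then (1:ℤ) else 0))
      + (if (((aB ∨ true) ∧ (b'B ∨ b'α) ∧ ¬ a'T ∧ ¬ bT) ∨ ((a'B ∨ false) ∧ (bB ∨ bα) ∧ ¬ aT ∧ ¬ b'T)) then (1:ℤ) else 0) := by
  decide

set_option synthInstance.maxSize 100000 in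
/-- pattern `{B,T}`: hub bottom and hub top, `q_B + q_T ≥ 0`, with the `α`-bits of `a, a′` fixed to `false, true` (`decide`). -/
private theorem loc_BT_ft : ∀ (aB aT a'B a'T bB bT bα b'B b'T b'α : Bool),
    (aB = true → aT = true) → (false = true → aT = true) → (a'B = true → a'T = true) → (true = true → a'T = true) → (bB = true → bT = true) → (bα = true → bT = true) → (b'B = true → b'T = true) → (b'α = true → b'T = true) →
    0 ≤ ((if aB then (1:ℤ) else 0) - (if a'B then (1:ℤ) else 0)) * ((if bB then (1:ℤ) else 0) - (if b'B then (1:ℤ) else 0))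
      + (if ((aT ∧ ¬ a'B ∧ ¬ bB ∧ b'T) ∨ (¬ aB ∧ a'T ∧ bT ∧ ¬ b'B)) then (1:ℤ) else 0)
      + ((if aT then (1:ℤ) else 0) - (if a'T then (1:ℤ) else 0)) * ((if bT then (1:ℤ) else 0) - (if b'T then (1:ℤ) else 0))
      + (if (((aB ∨ false) ∧ (b'B ∨ b'α) ∧ ¬ a'T ∧ ¬ bT) ∨ ((a'B ∨ true) ∧ (bB ∨ bα) ∧ ¬ aT ∧ ¬ b'T)) then (1:ℤ) else 0) := by
  decide

set_option synthInstance.maxSize 100000 in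
/-- pattern `{B,T}`: hub bottom and hub top, `q_B + q_T ≥ 0`, with the `α`-bits of `a, a′` fixed to `false, false` (`decide`). -/
private theorem loc_BT_ff : ∀ (aB aT a'B a'T bB bT bα b'B b'T b'α : Bool),
    (aB = true → aT = true) → (false = true → aT = true) → (a'B = true → a'T = true) → (false = true → a'T = true) → (bB = true → bT = true) → (bα = true → bT = true) → (b'B = true → b'T = true) → (b'α = true → b'T = true) →
    0 ≤ ((if aB then (1:ℤ) else 0) - (if a'B then (1:ℤ) else 0)) * ((if bB then (1:ℤ) else 0) - (if b'B then (1:ℤ) else 0))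
      + (if ((aT ∧ ¬ a'B ∧ ¬ bB ∧ b'T) ∨ (¬ aB ∧ a'T ∧ bT ∧ ¬ b'B)) then (1:ℤ) else 0)
      + ((if aT then (1:ℤ) else 0) - (if a'T then (1:ℤ) else 0)) * ((if bT then (1:ℤ) else 0) - (if b'T then (1:ℤ) else 0))
      + (if (((aB ∨ false) ∧ (b'B ∨ b'α) ∧ ¬ a'T ∧ ¬ bT) ∨ ((a'B ∨ false) ∧ (bB ∨ bα) ∧ ¬ aT ∧ ¬ b'T)) then (1:ℤ) else 0) := by
  decide

/-- **LOCALIZED PURE HUB LEMMA**, pattern `{B,T}`: hub bottom and hub top, `q_B + q_T ≥ 0`.  Sixteen bits (for each of `a, a′, b, b′`: membership of the hub bottom `B`,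
the hub top `T`, of some `F′`-bottom below the hub top (`α`), of the `F′`-top `τ`), constrained by `B ⇒ T`, `α ⇒ T`, `B ⇒ τ`;
pointwise products (no involution).  (Bits and constraints not entering this pattern are carried for a uniform interface.) [this work] -/
theorem pure_hub_local_BT (aB aT aα aτ a'B a'T a'α a'τ bB bT bα bτ b'B b'T b'α b'τ : Bool)
    (h1 : aB = true → aT = true)
    (h2 : aα = true → aT = true)
    (_h3 : aB = true → aτ = true)
    (h4 : a'B = true → a'T = true)
    (h5 : a'α = true → a'T = true)
    (_h6 : a'B = true → a'τ = true)
    (h7 : bB = true → bT = true)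
    (h8 : bα = true → bT = true)
    (_h9 : bB = true → bτ = true)
    (h10 : b'B = true → b'T = true)
    (h11 : b'α = true → b'T = true)
    (_h12 : b'B = true → b'τ = true) :
    0 ≤ ((if aB then (1:ℤ) else 0) - (if a'B then (1:ℤ) else 0)) * ((if bB then (1:ℤ) else 0) - (if b'B then (1:ℤ) else 0))
      + (if ((aT ∧ ¬ a'B ∧ ¬ bB ∧ b'T) ∨ (¬ aB ∧ a'T ∧ bT ∧ ¬ b'B)) then (1:ℤ) else 0)
      + ((if aT then (1:ℤ) else 0) - (if a'T then (1:ℤ) else 0)) * ((if bT then (1:ℤ) else 0) - (if b'T then (1:ℤ) else 0))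
      + (if (((aB ∨ aα) ∧ (b'B ∨ b'α) ∧ ¬ a'T ∧ ¬ bT) ∨ ((a'B ∨ a'α) ∧ (bB ∨ bα) ∧ ¬ aT ∧ ¬ b'T)) then (1:ℤ) else 0) := by
  cases aα <;> cases a'α
  · exact loc_BT_ff aB aT a'B a'T bB bT bα b'B b'T b'α h1 h2 h4 h5 h7 h8 h10 h11
  · exact loc_BT_ft aB aT a'B a'T bB bT bα b'B b'T b'α h1 h2 h4 h5 h7 h8 h10 h11
  · exact loc_BT_tf aB aT a'B a'T bB bT bα b'B b'T b'α h1 h2 h4 h5 h7 h8 h10 h11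
  · exact loc_BT_tt aB aT a'B a'T bB bT bα b'B b'T b'α h1 h2 h4 h5 h7 h8 h10 h11

set_option synthInstance.maxSize 100000 in
/-- pattern `{B,τ}`: hub bottom and the `F′`-top, `q_B + (c_new − c_old) ≥ 0`, with the `α`-bits of `a, a′` fixed to `true, true` (`decide`). -/
private theorem loc_Btau_tt : ∀ (aB aT aτ a'B a'T a'τ bB bT bα bτ b'B b'T b'α b'τ : Bool),
    (aB = true → aT = true) → (true = true → aT = true) → (aB = true → aτ = true) → (a'B = true → a'T = true) → (true = true → a'T = true) → (a'B = true → a'τ = true) → (bB = true → bT = true) → (bα = true → bT = true) → (bB = true → bτ = true) → (b'B = true → b'T = true) → (b'α = true → b'T = true) → (b'B = true → b'τ = true) →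
    0 ≤ ((if aB then (1:ℤ) else 0) - (if a'B then (1:ℤ) else 0)) * ((if bB then (1:ℤ) else 0) - (if b'B then (1:ℤ) else 0))
      + (if ((aT ∧ ¬ a'B ∧ ¬ bB ∧ b'T) ∨ (¬ aB ∧ a'T ∧ bT ∧ ¬ b'B)) then (1:ℤ) else 0)
      + (if ((aB ∧ b'B ∧ ¬ a'τ ∧ ¬ bτ) ∨ (a'B ∧ bB ∧ ¬ aτ ∧ ¬ b'τ)) then (1:ℤ) else 0)
      - (if ((true ∧ b'α ∧ ¬ a'τ ∧ ¬ bτ) ∨ (true ∧ bα ∧ ¬ aτ ∧ ¬ b'τ)) then (1:ℤ) else 0) := by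
  decide

set_option synthInstance.maxSize 100000 in
/-- pattern `{B,τ}`: hub bottom and the `F′`-top, `q_B + (c_new − c_old) ≥ 0`, with the `α`-bits of `a, a′` fixed to `true, false` (`decide`). -/
private theorem loc_Btau_tf : ∀ (aB aT aτ a'B a'T a'τ bB bT bα bτ b'B b'T b'α b'τ : Bool),
    (aB = true → aT = true) → (true = true → aT = true) → (aB = true → aτ = true) → (a'B = true → a'T = true) → (false = true → a'T = true) → (a'B = true → a'τ = true) → (bB = true → bT = true) → (bα = true → bT = true) → (bB = true → bτ = true) → (b'B = true → b'T = true) → (b'α = true → b'T = true) → (b'B = true → b'τ = true) →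
    0 ≤ ((if aB then (1:ℤ) else 0) - (if a'B then (1:ℤ) else 0)) * ((if bB then (1:ℤ) else 0) - (if b'B then (1:ℤ) else 0))
      + (if ((aT ∧ ¬ a'B ∧ ¬ bB ∧ b'T) ∨ (¬ aB ∧ a'T ∧ bT ∧ ¬ b'B)) then (1:ℤ) else 0)
      + (if ((aB ∧ b'B ∧ ¬ a'τ ∧ ¬ bτ) ∨ (a'B ∧ bB ∧ ¬ aτ ∧ ¬ b'τ)) then (1:ℤ) else 0)
      - (if ((true ∧ b'α ∧ ¬ a'τ ∧ ¬ bτ) ∨ (false ∧ bα ∧ ¬ aτ ∧ ¬ b'τ)) then (1:ℤ) else 0) := by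
  decide

set_option synthInstance.maxSize 100000 in
/-- pattern `{B,τ}`: hub bottom and the `F′`-top, `q_B + (c_new − c_old) ≥ 0`, with the `α`-bits of `a, a′` fixed to `false, true` (`decide`). -/
private theorem loc_Btau_ft : ∀ (aB aT aτ a'B a'T a'τ bB bT bα bτ b'B b'T b'α b'τ : Bool),
    (aB = true → aT = true) → (false = true → aT = true) → (aB = true → aτ = true) → (a'B = true → a'T = true) → (true = true → a'T = true) → (a'B = true → a'τ = true) → (bB = true → bT = true) → (bα = true → bT = true) → (bB = true → bτ = true) → (b'B = true → b'T = true) → (b'α = true → b'T = true) → (b'B = true → b'τ = true) →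
    0 ≤ ((if aB then (1:ℤ) else 0) - (if a'B then (1:ℤ) else 0)) * ((if bB then (1:ℤ) else 0) - (if b'B then (1:ℤ) else 0))
      + (if ((aT ∧ ¬ a'B ∧ ¬ bB ∧ b'T) ∨ (¬ aB ∧ a'T ∧ bT ∧ ¬ b'B)) then (1:ℤ) else 0)
      + (if ((aB ∧ b'B ∧ ¬ a'τ ∧ ¬ bτ) ∨ (a'B ∧ bB ∧ ¬ aτ ∧ ¬ b'τ)) then (1:ℤ) else 0)
      - (if ((false ∧ b'α ∧ ¬ a'τ ∧ ¬ bτ) ∨ (true ∧ bα ∧ ¬ aτ ∧ ¬ b'τ)) then (1:ℤ) else 0) := by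
  decide

set_option synthInstance.maxSize 100000 in
/-- pattern `{B,τ}`: hub bottom and the `F′`-top, `q_B + (c_new − c_old) ≥ 0`, with the `α`-bits of `a, a′` fixed to `false, false` (`decide`). -/
private theorem loc_Btau_ff : ∀ (aB aT aτ a'B a'T a'τ bB bT bα bτ b'B b'T b'α b'τ : Bool),
    (aB = true → aT = true) → (false = true → aT = true) → (aB = true → aτ = true) → (a'B = true → a'T = true) → (false = true → a'T = true) → (a'B = true → a'τ = true) → (bB = true → bT = true) → (bα = true → bT = true) → (bB = true → bτ = true) → (b'B = true → b'T = true) → (b'α = true → b'T = true) → (b'B = true → b'τ = true) →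
    0 ≤ ((if aB then (1:ℤ) else 0) - (if a'B then (1:ℤ) else 0)) * ((if bB then (1:ℤ) else 0) - (if b'B then (1:ℤ) else 0))
      + (if ((aT ∧ ¬ a'B ∧ ¬ bB ∧ b'T) ∨ (¬ aB ∧ a'T ∧ bT ∧ ¬ b'B)) then (1:ℤ) else 0)
      + (if ((aB ∧ b'B ∧ ¬ a'τ ∧ ¬ bτ) ∨ (a'B ∧ bB ∧ ¬ aτ ∧ ¬ b'τ)) then (1:ℤ) else 0)
      - (if ((false ∧ b'α ∧ ¬ a'τ ∧ ¬ bτ) ∨ (false ∧ bα ∧ ¬ aτ ∧ ¬ b'τ)) then (1:ℤ) else 0) := by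
  decide

/-- **LOCALIZED PURE HUB LEMMA**, pattern `{B,τ}`: hub bottom and the `F′`-top, `q_B + (c_new − c_old) ≥ 0`.  Sixteen bits (for each of `a, a′, b, b′`: membership of the hub bottom `B`,
the hub top `T`, of some `F′`-bottom below the hub top (`α`), of the `F′`-top `τ`), constrained by `B ⇒ T`, `α ⇒ T`, `B ⇒ τ`;
pointwise products (no involution).  (Bits and constraints not entering this pattern are carried for a uniform interface.) [this work] -/
theorem pure_hub_local_Btau (aB aT aα aτ a'B a'T a'α a'τ bB bT bα bτ b'B b'T b'α b'τ : Bool)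
    (h1 : aB = true → aT = true)
    (h2 : aα = true → aT = true)
    (h3 : aB = true → aτ = true)
    (h4 : a'B = true → a'T = true)
    (h5 : a'α = true → a'T = true)
    (h6 : a'B = true → a'τ = true)
    (h7 : bB = true → bT = true)
    (h8 : bα = true → bT = true)
    (h9 : bB = true → bτ = true)
    (h10 : b'B = true → b'T = true)
    (h11 : b'α = true → b'T = true)
    (h12 : b'B = true → b'τ = true) :
    0 ≤ ((if aB then (1:ℤ) else 0) - (if a'B then (1:ℤ) else 0)) * ((if bB then (1:ℤ) else 0) - (if b'B then (1:ℤ) else 0))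
      + (if ((aT ∧ ¬ a'B ∧ ¬ bB ∧ b'T) ∨ (¬ aB ∧ a'T ∧ bT ∧ ¬ b'B)) then (1:ℤ) else 0)
      + (if ((aB ∧ b'B ∧ ¬ a'τ ∧ ¬ bτ) ∨ (a'B ∧ bB ∧ ¬ aτ ∧ ¬ b'τ)) then (1:ℤ) else 0)
      - (if ((aα ∧ b'α ∧ ¬ a'τ ∧ ¬ bτ) ∨ (a'α ∧ bα ∧ ¬ aτ ∧ ¬ b'τ)) then (1:ℤ) else 0) := by
  cases aα <;> cases a'α
  · exact loc_Btau_ff aB aT aτ a'B a'T a'τ bB bT bα bτ b'B b'T b'α b'τ h1 h2 h3 h4 h5 h6 h7 h8 h9 h10 h11 h12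
  · exact loc_Btau_ft aB aT aτ a'B a'T a'τ bB bT bα bτ b'B b'T b'α b'τ h1 h2 h3 h4 h5 h6 h7 h8 h9 h10 h11 h12
  · exact loc_Btau_tf aB aT aτ a'B a'T a'τ bB bT bα bτ b'B b'T b'α b'τ h1 h2 h3 h4 h5 h6 h7 h8 h9 h10 h11 h12
  · exact loc_Btau_tt aB aT aτ a'B a'T a'τ bB bT bα bτ b'B b'T b'α b'τ h1 h2 h3 h4 h5 h6 h7 h8 h9 h10 h11 h12

set_option synthInstance.maxSize 100000 in
/-- pattern `{B,T,τ}` (the whole level): `q_B + q_T + c_new − c_old ≥ 0`, with the `α`-bits of `a, a′` fixed to `true, true` (`decide`). -/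
private theorem loc_all_tt : ∀ (aB aT aτ a'B a'T a'τ bB bT bα bτ b'B b'T b'α b'τ : Bool),
    (aB = true → aT = true) → (true = true → aT = true) → (aB = true → aτ = true) → (a'B = true → a'T = true) → (true = true → a'T = true) → (a'B = true → a'τ = true) → (bB = true → bT = true) → (bα = true → bT = true) → (bB = true → bτ = true) → (b'B = true → b'T = true) → (b'α = true → b'T = true) → (b'B = true → b'τ = true) →
    0 ≤ ((if aB then (1:ℤ) else 0) - (if a'B then (1:ℤ) else 0)) * ((if bB then (1:ℤ) else 0) - (if b'B then (1:ℤ) else 0))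
      + (if ((aT ∧ ¬ a'B ∧ ¬ bB ∧ b'T) ∨ (¬ aB ∧ a'T ∧ bT ∧ ¬ b'B)) then (1:ℤ) else 0)
      + ((if aT then (1:ℤ) else 0) - (if a'T then (1:ℤ) else 0)) * ((if bT then (1:ℤ) else 0) - (if b'T then (1:ℤ) else 0))
      + (if (((aB ∨ true) ∧ (b'B ∨ b'α) ∧ ¬ a'T ∧ ¬ bT) ∨ ((a'B ∨ true) ∧ (bB ∨ bα) ∧ ¬ aT ∧ ¬ b'T)) then (1:ℤ) else 0)
      + (if ((aB ∧ b'B ∧ ¬ a'τ ∧ ¬ bτ) ∨ (a'B ∧ bB ∧ ¬ aτ ∧ ¬ b'τ)) then (1:ℤ) else 0)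
      - (if ((true ∧ b'α ∧ ¬ a'τ ∧ ¬ bτ) ∨ (true ∧ bα ∧ ¬ aτ ∧ ¬ b'τ)) then (1:ℤ) else 0) := by
  decide

set_option synthInstance.maxSize 100000 in
/-- pattern `{B,T,τ}` (the whole level): `q_B + q_T + c_new − c_old ≥ 0`, with the `α`-bits of `a, a′` fixed to `true, false` (`decide`). -/
private theorem loc_all_tf : ∀ (aB aT aτ a'B a'T a'τ bB bT bα bτ b'B b'T b'α b'τ : Bool),
    (aB = true → aT = true) → (true = true → aT = true) → (aB = true → aτ = true) → (a'B = true → a'T = true) → (false = true → a'T = true) → (a'B = true → a'τ = true) → (bB = true → bT = true) → (bα = true → bT = true) → (bB = true → bτ = true) → (b'B = true → b'T = true) → (b'α = true → b'T = true) → (b'B = true → b'τ = true) →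
    0 ≤ ((if aB then (1:ℤ) else 0) - (if a'B then (1:ℤ) else 0)) * ((if bB then (1:ℤ) else 0) - (if b'B then (1:ℤ) else 0))
      + (if ((aT ∧ ¬ a'B ∧ ¬ bB ∧ b'T) ∨ (¬ aB ∧ a'T ∧ bT ∧ ¬ b'B)) then (1:ℤ) else 0)
      + ((if aT then (1:ℤ) else 0) - (if a'T then (1:ℤ) else 0)) * ((if bT then (1:ℤ) else 0) - (if b'T then (1:ℤ) else 0))
      + (if (((aB ∨ true) ∧ (b'B ∨ b'α) ∧ ¬ a'T ∧ ¬ bT) ∨ ((a'B ∨ false) ∧ (bB ∨ bα) ∧ ¬ aT ∧ ¬ b'T)) then (1:ℤ) else 0)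
      + (if ((aB ∧ b'B ∧ ¬ a'τ ∧ ¬ bτ) ∨ (a'B ∧ bB ∧ ¬ aτ ∧ ¬ b'τ)) then (1:ℤ) else 0)
      - (if ((true ∧ b'α ∧ ¬ a'τ ∧ ¬ bτ) ∨ (false ∧ bα ∧ ¬ aτ ∧ ¬ b'τ)) then (1:ℤ) else 0) := by
  decide

set_option synthInstance.maxSize 100000 in
/-- pattern `{B,T,τ}` (the whole level): `q_B + q_T + c_new − c_old ≥ 0`, with the `α`-bits of `a, a′` fixed to `false, true` (`decide`). -/
private theorem loc_all_ft : ∀ (aB aT aτ a'B a'T a'τ bB bT bα bτ b'B b'T b'α b'τ : Bool),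
    (aB = true → aT = true) → (false = true → aT = true) → (aB = true → aτ = true) → (a'B = true → a'T = true) → (true = true → a'T = true) → (a'B = true → a'τ = true) → (bB = true → bT = true) → (bα = true → bT = true) → (bB = true → bτ = true) → (b'B = true → b'T = true) → (b'α = true → b'T = true) → (b'B = true → b'τ = true) →
    0 ≤ ((if aB then (1:ℤ) else 0) - (if a'B then (1:ℤ) else 0)) * ((if bB then (1:ℤ) else 0) - (if b'B then (1:ℤ) else 0))
      + (if ((aT ∧ ¬ a'B ∧ ¬ bB ∧ b'T) ∨ (¬ aB ∧ a'T ∧ bT ∧ ¬ b'B)) then (1:ℤ) else 0)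
      + ((if aT then (1:ℤ) else 0) - (if a'T then (1:ℤ) else 0)) * ((if bT then (1:ℤ) else 0) - (if b'T then (1:ℤ) else 0))
      + (if (((aB ∨ false) ∧ (b'B ∨ b'α) ∧ ¬ a'T ∧ ¬ bT) ∨ ((a'B ∨ true) ∧ (bB ∨ bα) ∧ ¬ aT ∧ ¬ b'T)) then (1:ℤ) else 0)
      + (if ((aB ∧ b'B ∧ ¬ a'τ ∧ ¬ bτ) ∨ (a'B ∧ bB ∧ ¬ aτ ∧ ¬ b'τ)) then (1:ℤ) else 0)
      - (if ((false ∧ b'α ∧ ¬ a'τ ∧ ¬ bτ) ∨ (true ∧ bα ∧ ¬ aτ ∧ ¬ b'τ)) then (1:ℤ) else 0) := by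
  decide

set_option synthInstance.maxSize 100000 in
/-- pattern `{B,T,τ}` (the whole level): `q_B + q_T + c_new − c_old ≥ 0`, with the `α`-bits of `a, a′` fixed to `false, false` (`decide`). -/
private theorem loc_all_ff : ∀ (aB aT aτ a'B a'T a'τ bB bT bα bτ b'B b'T b'α b'τ : Bool),
    (aB = true → aT = true) → (false = true → aT = true) → (aB = true → aτ = true) → (a'B = true → a'T = true) → (false = true → a'T = true) → (a'B = true → a'τ = true) → (bB = true → bT = true) → (bα = true → bT = true) → (bB = true → bτ = true) → (b'B = true → b'T = true) → (b'α = true → b'T = true) → (b'B = true → b'τ = true) →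
    0 ≤ ((if aB then (1:ℤ) else 0) - (if a'B then (1:ℤ) else 0)) * ((if bB then (1:ℤ) else 0) - (if b'B then (1:ℤ) else 0))
      + (if ((aT ∧ ¬ a'B ∧ ¬ bB ∧ b'T) ∨ (¬ aB ∧ a'T ∧ bT ∧ ¬ b'B)) then (1:ℤ) else 0)
      + ((if aT then (1:ℤ) else 0) - (if a'T then (1:ℤ) else 0)) * ((if bT then (1:ℤ) else 0) - (if b'T then (1:ℤ) else 0))
      + (if (((aB ∨ false) ∧ (b'B ∨ b'α) ∧ ¬ a'T ∧ ¬ bT) ∨ ((a'B ∨ false) ∧ (bB ∨ bα) ∧ ¬ aT ∧ ¬ b'T)) then (1:ℤ) else 0)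
      + (if ((aB ∧ b'B ∧ ¬ a'τ ∧ ¬ bτ) ∨ (a'B ∧ bB ∧ ¬ aτ ∧ ¬ b'τ)) then (1:ℤ) else 0)
      - (if ((false ∧ b'α ∧ ¬ a'τ ∧ ¬ bτ) ∨ (false ∧ bα ∧ ¬ aτ ∧ ¬ b'τ)) then (1:ℤ) else 0) := by
  decide

/-- **LOCALIZED PURE HUB LEMMA**, pattern `{B,T,τ}` (the whole level): `q_B + q_T + c_new − c_old ≥ 0`.  Sixteen bits (for each of `a, a′, b, b′`: membership of the hub bottom `B`,
the hub top `T`, of some `F′`-bottom below the hub top (`α`), of the `F′`-top `τ`), constrained by `B ⇒ T`, `α ⇒ T`, `B ⇒ τ`;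
pointwise products (no involution).  (Bits and constraints not entering this pattern are carried for a uniform interface.) [this work] -/
theorem pure_hub_local_all (aB aT aα aτ a'B a'T a'α a'τ bB bT bα bτ b'B b'T b'α b'τ : Bool)
    (h1 : aB = true → aT = true)
    (h2 : aα = true → aT = true)
    (h3 : aB = true → aτ = true)
    (h4 : a'B = true → a'T = true)
    (h5 : a'α = true → a'T = true)
    (h6 : a'B = true → a'τ = true)
    (h7 : bB = true → bT = true)
    (h8 : bα = true → bT = true)
    (h9 : bB = true → bτ = true)
    (h10 : b'B = true → b'T = true)
    (h11 : b'α = true → b'T = true)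
    (h12 : b'B = true → b'τ = true) :
    0 ≤ ((if aB then (1:ℤ) else 0) - (if a'B then (1:ℤ) else 0)) * ((if bB then (1:ℤ) else 0) - (if b'B then (1:ℤ) else 0))
      + (if ((aT ∧ ¬ a'B ∧ ¬ bB ∧ b'T) ∨ (¬ aB ∧ a'T ∧ bT ∧ ¬ b'B)) then (1:ℤ) else 0)
      + ((if aT then (1:ℤ) else 0) - (if a'T then (1:ℤ) else 0)) * ((if bT then (1:ℤ) else 0) - (if b'T then (1:ℤ) else 0))
      + (if (((aB ∨ aα) ∧ (b'B ∨ b'α) ∧ ¬ a'T ∧ ¬ bT) ∨ ((a'B ∨ a'α) ∧ (bB ∨ bα) ∧ ¬ aT ∧ ¬ b'T)) then (1:ℤ) else 0)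
      + (if ((aB ∧ b'B ∧ ¬ a'τ ∧ ¬ bτ) ∨ (a'B ∧ bB ∧ ¬ aτ ∧ ¬ b'τ)) then (1:ℤ) else 0)
      - (if ((aα ∧ b'α ∧ ¬ a'τ ∧ ¬ bτ) ∨ (a'α ∧ bα ∧ ¬ aτ ∧ ¬ b'τ)) then (1:ℤ) else 0) := by
  cases aα <;> cases a'α
  · exact loc_all_ff aB aT aτ a'B a'T a'τ bB bT bα bτ b'B b'T b'α b'τ h1 h2 h3 h4 h5 h6 h7 h8 h9 h10 h11 h12
  · exact loc_all_ft aB aT aτ a'B a'T a'τ bB bT bα bτ b'B b'T b'α b'τ h1 h2 h3 h4 h5 h6 h7 h8 h9 h10 h11 h12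
  · exact loc_all_tf aB aT aτ a'B a'T a'τ bB bT bα bτ b'B b'T b'α b'τ h1 h2 h3 h4 h5 h6 h7 h8 h9 h10 h11 h12
  · exact loc_all_tt aB aT aτ a'B a'T a'τ bB bT bα bτ b'B b'T b'α b'τ h1 h2 h3 h4 h5 h6 h7 h8 h9 h10 h11 h12


variable {Y : Type*} [Fintype Y] [DecidableEq Y]

/-- **LOCALIZED PURE HUB CHARGE** (memo §2).  Levels indexed by an arbitrary finite type `Y`; for each of `S = a, a′, b, b′` four families
`S_B ⊆ S_T`, `S_α ⊆ S_T`, `S_τ ⊇ S_B` of levels (traces of the up-set `S` on hub bottoms, hub tops, on the `F′`-bottoms below the hub top,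
on the `F′`-tops), and a DOWN-SET PATTERN: families `ZT ⊆ ZB`, `Zτ ⊆ ZB` (the levels whose hub top / `F′`-top / hub bottom lie in the
down-set `Z`; `B_y < T_y` and `B_y < τ_y` force the inclusions).  Then the `Z`-restricted pure hub sum is nonnegative — termwise, by
`pure_hub_local_*`; no upper-family hypothesis and no mixing is needed. [this work] -/
theorem pure_hub_charge (aB aT aα aτ a'B a'T a'α a'τ bB bT bα bτ b'B b'T b'α b'τ ZB ZT Zτ : Finset Y)
    (h1 : aB ⊆ aT) (h2 : aα ⊆ aT) (h3 : aB ⊆ aτ) (h4 : a'B ⊆ a'T) (h5 : a'α ⊆ a'T) (h6 : a'B ⊆ a'τ)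
    (h7 : bB ⊆ bT) (h8 : bα ⊆ bT) (h9 : bB ⊆ bτ) (h10 : b'B ⊆ b'T) (h11 : b'α ⊆ b'T) (h12 : b'B ⊆ b'τ)
    (hZT : ZT ⊆ ZB) (hZτ : Zτ ⊆ ZB) :
    0 ≤ ∑ y : Y,
        ((if y ∈ ZB then (1:ℤ) else 0) *
            (((if y ∈ aB then (1:ℤ) else 0) - (if y ∈ a'B then (1:ℤ) else 0)) * ((if y ∈ bB then (1:ℤ) else 0) - (if y ∈ b'B then (1:ℤ) else 0))
              + (if ((y ∈ aT ∧ y ∉ a'B ∧ y ∉ bB ∧ y ∈ b'T) ∨ (y ∉ aB ∧ y ∈ a'T ∧ y ∈ bT ∧ y ∉ b'B)) then (1:ℤ) else 0))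
        + (if y ∈ ZT then (1:ℤ) else 0) *
            (((if y ∈ aT then (1:ℤ) else 0) - (if y ∈ a'T then (1:ℤ) else 0)) * ((if y ∈ bT then (1:ℤ) else 0) - (if y ∈ b'T then (1:ℤ) else 0))
              + (if (((y ∈ aB ∨ y ∈ aα) ∧ (y ∈ b'B ∨ y ∈ b'α) ∧ y ∉ a'T ∧ y ∉ bT)
                    ∨ ((y ∈ a'B ∨ y ∈ a'α) ∧ (y ∈ bB ∨ y ∈ bα) ∧ y ∉ aT ∧ y ∉ b'T)) then (1:ℤ) else 0))
        + (if y ∈ Zτ then (1:ℤ) else 0) *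
            ((if ((y ∈ aB ∧ y ∈ b'B ∧ y ∉ a'τ ∧ y ∉ bτ) ∨ (y ∈ a'B ∧ y ∈ bB ∧ y ∉ aτ ∧ y ∉ b'τ)) then (1:ℤ) else 0)
              - (if ((y ∈ aα ∧ y ∈ b'α ∧ y ∉ a'τ ∧ y ∉ bτ) ∨ (y ∈ a'α ∧ y ∈ bα ∧ y ∉ aτ ∧ y ∉ b'τ)) then (1:ℤ) else 0))) := by
  refine Finset.sum_nonneg (fun y _ => ?_)
  have c1 : decide (y ∈ aB) = true → decide (y ∈ aT) = true := by simpa using fun h => h1 h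
  have c2 : decide (y ∈ aα) = true → decide (y ∈ aT) = true := by simpa using fun h => h2 h
  have c3 : decide (y ∈ aB) = true → decide (y ∈ aτ) = true := by simpa using fun h => h3 h
  have c4 : decide (y ∈ a'B) = true → decide (y ∈ a'T) = true := by simpa using fun h => h4 h
  have c5 : decide (y ∈ a'α) = true → decide (y ∈ a'T) = true := by simpa using fun h => h5 h
  have c6 : decide (y ∈ a'B) = true → decide (y ∈ a'τ) = true := by simpa using fun h => h6 h
  have c7 : decide (y ∈ bB) = true → decide (y ∈ bT) = true := by simpa using fun h => h7 h
  have c8 : decide (y ∈ bα) = true → decide (y ∈ bT) = true := by simpa using fun h => h8 h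
  have c9 : decide (y ∈ bB) = true → decide (y ∈ bτ) = true := by simpa using fun h => h9 h
  have c10 : decide (y ∈ b'B) = true → decide (y ∈ b'T) = true := by simpa using fun h => h10 h
  have c11 : decide (y ∈ b'α) = true → decide (y ∈ b'T) = true := by simpa using fun h => h11 h
  have c12 : decide (y ∈ b'B) = true → decide (y ∈ b'τ) = true := by simpa using fun h => h12 h
  have kB := pure_hub_local_B (decide (y ∈ aB)) (decide (y ∈ aT)) (decide (y ∈ aα)) (decide (y ∈ aτ))
      (decide (y ∈ a'B)) (decide (y ∈ a'T)) (decide (y ∈ a'α)) (decide (y ∈ a'τ))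
      (decide (y ∈ bB)) (decide (y ∈ bT)) (decide (y ∈ bα)) (decide (y ∈ bτ))
      (decide (y ∈ b'B)) (decide (y ∈ b'T)) (decide (y ∈ b'α)) (decide (y ∈ b'τ)) c1 c2 c3 c4 c5 c6 c7 c8 c9 c10 c11 c12
  have kBT := pure_hub_local_BT (decide (y ∈ aB)) (decide (y ∈ aT)) (decide (y ∈ aα)) (decide (y ∈ aτ))
      (decide (y ∈ a'B)) (decide (y ∈ a'T)) (decide (y ∈ a'α)) (decide (y ∈ a'τ))
      (decide (y ∈ bB)) (decide (y ∈ bT)) (decide (y ∈ bα)) (decide (y ∈ bτ))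
      (decide (y ∈ b'B)) (decide (y ∈ b'T)) (decide (y ∈ b'α)) (decide (y ∈ b'τ)) c1 c2 c3 c4 c5 c6 c7 c8 c9 c10 c11 c12
  have kBτ := pure_hub_local_Btau (decide (y ∈ aB)) (decide (y ∈ aT)) (decide (y ∈ aα)) (decide (y ∈ aτ))
      (decide (y ∈ a'B)) (decide (y ∈ a'T)) (decide (y ∈ a'α)) (decide (y ∈ a'τ))
      (decide (y ∈ bB)) (decide (y ∈ bT)) (decide (y ∈ bα)) (decide (y ∈ bτ))
      (decide (y ∈ b'B)) (decide (y ∈ b'T)) (decide (y ∈ b'α)) (decide (y ∈ b'τ)) c1 c2 c3 c4 c5 c6 c7 c8 c9 c10 c11 c12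
  have kall := pure_hub_local_all (decide (y ∈ aB)) (decide (y ∈ aT)) (decide (y ∈ aα)) (decide (y ∈ aτ))
      (decide (y ∈ a'B)) (decide (y ∈ a'T)) (decide (y ∈ a'α)) (decide (y ∈ a'τ))
      (decide (y ∈ bB)) (decide (y ∈ bT)) (decide (y ∈ bα)) (decide (y ∈ bτ))
      (decide (y ∈ b'B)) (decide (y ∈ b'T)) (decide (y ∈ b'α)) (decide (y ∈ b'τ)) c1 c2 c3 c4 c5 c6 c7 c8 c9 c10 c11 c12
  simp only [decide_eq_true_eq] at kB kBT kBτ kall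
  by_cases zB : y ∈ ZB
  · by_cases zT : y ∈ ZT
    · by_cases zτ : y ∈ Zτ
      · simp only [zB, zT, zτ, if_true, one_mul]; linarith
      · simp only [zB, zT, zτ, if_true, if_false, one_mul, zero_mul, add_zero]; linarith
    · by_cases zτ : y ∈ Zτ
      · simp only [zB, zT, zτ, if_true, if_false, one_mul, zero_mul, add_zero]; linarith
      · simp only [zB, zT, zτ, if_true, if_false, one_mul, zero_mul, add_zero]; linarith
  · have zT : y ∉ ZT := fun h => zB (hZT h)
    have zτ : y ∉ Zτ := fun h => zB (hZτ h)
    simp only [zB, zT, zτ, if_false, zero_mul, add_zero]; exact le_refl _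


/-! ### From PURE to the mixed form: two antipodal-Kleitman instances -/

section PureLeMixed

variable {α : Type*} [Fintype α] [DecidableEq α]

omit [Fintype α] in
/-- For an involution `ι`, membership of `ι x` in `S` is membership of `x` in the image `S.image ι`. -/
private theorem mem_image_invol (ι : α → α) (hι : Function.Involutive ι) (S : Finset α) (x : α) :
    ι x ∈ S ↔ x ∈ S.image ι := by
  constructor
  · intro h; exact Finset.mem_image.mpr ⟨ι x, h, hι x⟩
  · intro h
    obtain ⟨y, hy, rfl⟩ := Finset.mem_image.mp h
    rw [hι y]; exact hy

/-- `#(S ∩ T)` as an indicator sum. -/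
private theorem card_inter_eq_sum' (S T : Finset α) :
    ((S ∩ T).card : ℤ) = ∑ x : α, (if x ∈ S then (1:ℤ) else 0) * (if x ∈ T then (1:ℤ) else 0) := by
  have : ∀ x : α, (if x ∈ S then (1:ℤ) else 0) * (if x ∈ T then (1:ℤ) else 0) = if x ∈ S ∩ T then (1:ℤ) else 0 := by
    intro x
    by_cases h1 : x ∈ S <;> by_cases h2 : x ∈ T <;> simp [h1, h2, Finset.mem_inter]
  simp_rw [this]
  rw [Finset.sum_boole, Finset.filter_mem_eq_inter, Finset.univ_inter]

/-- The expansion `Σ_x (1_S x − 1_T x)(1_U x − 1_V x) = #(S∩U) − #(S∩V) − #(T∩U) + #(T∩V)`. -/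
private theorem sum_sub_mul_sub' (S T U V : Finset α) :
    ∑ x : α, ((if x ∈ S then (1:ℤ) else 0) - (if x ∈ T then (1:ℤ) else 0)) *
        ((if x ∈ U then (1:ℤ) else 0) - (if x ∈ V then (1:ℤ) else 0))
      = ((S ∩ U).card : ℤ) - (S ∩ V).card - (T ∩ U).card + (T ∩ V).card := by
  rw [card_inter_eq_sum', card_inter_eq_sum', card_inter_eq_sum', card_inter_eq_sum', ← Finset.sum_sub_distrib,
    ← Finset.sum_sub_distrib, ← Finset.sum_add_distrib]
  exact Finset.sum_congr rfl (fun x _ => by ring)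

/-- **PURE ≤ MIXED.**  For an involution `ι` of a finite type and finite sets `a, a′, b, b′`, if the two antipodal-Kleitman instances
`#(a ∩ ι b′) ≤ #(a ∩ b′)` and `#(ι a′ ∩ b) ≤ #(a′ ∩ b)` hold (for the colouring poset of a tree and up-sets these are THEOREM B /
RAA for trees), then the pure bilinear sum is dominated by the mixed (antithetic) one:
`Σ_x (1_a x − 1_{a′} x)(1_b x − 1_{b′} x) ≤ Σ_x (1_a x − 1_{a′}(ι x))(1_b x − 1_{b′}(ι x))`.
Hence `PURE(Y) ≥ 0 ⟹ val(Y) ≥ 0`: the `ι`-free inequality implies `(***)`. [this work] -/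
theorem pure_le_mixed (ι : α → α) (hι : Function.Involutive ι) (a a' b b' : Finset α)
    (h1 : (a ∩ b'.image ι).card ≤ (a ∩ b').card) (h2 : (a'.image ι ∩ b).card ≤ (a' ∩ b).card) :
    ∑ x : α, ((if x ∈ a then (1:ℤ) else 0) - (if x ∈ a' then (1:ℤ) else 0)) *
        ((if x ∈ b then (1:ℤ) else 0) - (if x ∈ b' then (1:ℤ) else 0))
      ≤ ∑ x : α, ((if x ∈ a then (1:ℤ) else 0) - (if ι x ∈ a' then (1:ℤ) else 0)) *
        ((if x ∈ b then (1:ℤ) else 0) - (if ι x ∈ b' then (1:ℤ) else 0)) := by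
  have ea : ∀ x : α, (if ι x ∈ a' then (1:ℤ) else 0) = (if x ∈ a'.image ι then (1:ℤ) else 0) := fun x => by simp only [mem_image_invol ι hι a' x]
  have eb : ∀ x : α, (if ι x ∈ b' then (1:ℤ) else 0) = (if x ∈ b'.image ι then (1:ℤ) else 0) := fun x => by simp only [mem_image_invol ι hι b' x]
  simp_rw [ea, eb]
  rw [sum_sub_mul_sub', sum_sub_mul_sub']
  have hinj : Function.Injective ι := hι.injective
  have e3 : (a'.image ι ∩ b'.image ι).card = (a' ∩ b').card := by
    rw [← Finset.image_inter _ _ hinj, Finset.card_image_of_injective _ hinj]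
  have h1' : ((a ∩ b'.image ι).card : ℤ) ≤ (a ∩ b').card := by exact_mod_cast h1
  have h2' : ((a'.image ι ∩ b).card : ℤ) ≤ (a' ∩ b).card := by exact_mod_cast h2
  rw [e3]; linarith

end PureLeMixed

end AntitheticPureHub

end Summit.CriticalPhenomena.PercolationContinuityZ3.Theorems
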